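import Literature.NumberTheory.GaloisRepresentations.WeilDeligneSemisimpleTraces
import Literature.NumberTheory.GaloisRepresentations.GenericWeilDeligneOrbitSemisimple
import Literature.RepresentationTheory.Semisimple.Twist
import HarnessLib

/-!
# `GenericWDUnique` (stmt-Langlands-2374), part I: characteristic-0 preliminaries

Support file for the proof of `Summit.Langlands.Langlands.Theses.EisensteinMonodromy.GenericWDUnique`
(item stmt-Langlands-2374).  The item quantifies over an ARBITRARY algebraically closed field of
characteristic `0`, while the tree's discharge of A'Campo–Hevesi–Thorne–Whitmore Prop. 6.0.5
(`WeilDeligneRep.AHTW2026_prop_6_0_5_generic_conj_holds`) and "Frobenius-semisimple ⇒ semisimple"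
(`WeilDeligneRep.IsFrobSemisimple.isSemisimpleRepresentation`) are over `ℂ`.  This file ports the
two complex-analytic ingredients:
* `exists_eigenGrading` — the tree's `WeilDeligneRep.exists_eigenGrading` grades `V` by the
  eigenvalues `μ` of a semisimple automorphism `S`, grouped by `⌊log_Q ‖μ‖⌋`; we replace the
  logarithm by a purely algebraic DEGREE FUNCTION `d : C → ℤ` with `d (Q μ) = d μ + 1` for `μ ≠ 0`
  (`exists_degreeFun`: a chosen representative of each orbit `Q^ℤ μ`; `Q ≥ 2` is not a root of unity
  in characteristic `0`), after which the proof is the tree's verbatim;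
* `isSemisimpleRepresentation_of_frobenius_scalar` — a `W_F`-representation with finitely many
  values on inertia on which a Frobenius power is a non-zero scalar is semisimple (unramified twist
  to finite image — the `m`-th root needs `C` algebraically closed — and Maschke,
  `isSemisimpleRepresentation_of_finite_range`, which needs `char C = 0`).
lens-3 g22 node twin (decomp-langlands), 2026-08-31.
-/

set_option linter.dupNamespace false

namespace Summit.Langlands.Langlands.Theorems

namespace GenericWDU

open Module
open Literature.NumberTheory.GaloisRepresentations
open Literature.NumberTheory.GaloisRepresentations.WeilGroup
open Literature.NumberTheory.GaloisRepresentations.IsNonarchimedeanLocalField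

/-- In characteristic `0`, an integer `Q ≥ 2` is not a root of unity: `(Q : C) ^ z = 1 → z = 0`. -/
theorem zpow_natCast_eq_one {C : Type*} [Field C] [CharZero C] {Q : ℕ} (hQ : 1 < Q) {z : ℤ}
    (h : (Q : C) ^ z = 1) : z = 0 := by
  have hnat : ∀ n : ℕ, (Q : C) ^ n = 1 → n = 0 := fun n hn => by
    have h1 : (Q ^ n : ℕ) = 1 := by exact_mod_cast hn
    by_contra hne
    exact absurd h1 (Nat.one_lt_pow hne hQ).ne'
  obtain ⟨n, rfl | rfl⟩ := z.eq_nat_or_neg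
  · rw [zpow_natCast] at h
    simp [hnat n h]
  · rw [zpow_neg, inv_eq_one, zpow_natCast] at h
    simp [hnat n h]

/-- `z ↦ (Q : C) ^ z` is injective for an integer `Q ≥ 2` in characteristic `0`. -/
theorem zpow_natCast_injective {C : Type*} [Field C] [CharZero C] {Q : ℕ} (hQ : 1 < Q) {a b : ℤ}
    (h : (Q : C) ^ a = (Q : C) ^ b) : a = b := by
  have hQC : (Q : C) ≠ 0 := by exact_mod_cast (zero_lt_one.trans hQ).ne'
  have h1 : (Q : C) ^ (a - b) = 1 := by
    rw [zpow_sub₀ hQC, h, div_self (zpow_ne_zero _ hQC)]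
  have := zpow_natCast_eq_one hQ h1
  omega

/-- **The algebraic degree function.**  For an integer `Q ≥ 2` and a field `C` of characteristic
`0` there is `d : C → ℤ` with `d (Q μ) = d μ + 1` for all `μ ≠ 0`: write `μ = Q ^ {-e} r` with `r`
a chosen representative of the orbit `Q^ℤ μ` and put `d μ = -e`. -/
theorem exists_degreeFun {C : Type*} [Field C] [CharZero C] {Q : ℕ} (hQ : 1 < Q) :
    ∃ d : C → ℤ, ∀ μ : C, μ ≠ 0 → d ((Q : C) * μ) = d μ + 1 := by
  classical
  have hQC : (Q : C) ≠ 0 := by exact_mod_cast (zero_lt_one.trans hQ).ne'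
  let orb : C → Set C := fun μ => {ν | ∃ j : ℤ, ν = (Q : C) ^ j * μ}
  have horb_self : ∀ μ, μ ∈ orb μ := fun μ => ⟨0, by simp⟩
  have horb_mul : ∀ μ, orb ((Q : C) * μ) = orb μ := by
    intro μ
    ext ν
    constructor
    · rintro ⟨j, rfl⟩
      exact ⟨j + 1, by rw [zpow_add_one₀ hQC]; ring⟩
    · rintro ⟨j, rfl⟩
      refine ⟨j - 1, ?_⟩
      rw [zpow_sub_one₀ hQC]
      field_simp
  let rep : C → C := fun μ => Classical.epsilon (fun ν => ν ∈ orb μ)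
  have hrep_mem : ∀ μ, ∃ j : ℤ, rep μ = (Q : C) ^ j * μ := fun μ =>
    Classical.epsilon_spec (p := fun ν => ν ∈ orb μ) ⟨μ, horb_self μ⟩
  have hrep_mul : ∀ μ, rep ((Q : C) * μ) = rep μ := fun μ => by
    change Classical.epsilon (fun ν => ν ∈ orb ((Q : C) * μ)) = Classical.epsilon (fun ν => ν ∈ orb μ)
    rw [horb_mul]
  choose e he using hrep_mem
  refine ⟨fun μ => -e μ, fun μ hμ => ?_⟩
  have h1 : (Q : C) ^ (e ((Q : C) * μ) + 1) * μ = (Q : C) ^ (e μ) * μ := by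
    rw [← he μ, ← hrep_mul μ, he ((Q : C) * μ), zpow_add_one₀ hQC, mul_assoc]
  have h2 : (Q : C) ^ (e ((Q : C) * μ) + 1) = (Q : C) ^ (e μ) := mul_right_cancel₀ hμ h1
  have h3 := zpow_natCast_injective hQ h2
  change -e ((Q : C) * μ) = -e μ + 1
  omega

/-- **The eigen-grading of a semisimple automorphism under `Q`-scaling, over any field of
characteristic `0`.**  Let `S` be a semisimple injective endomorphism of a finite-dimensional
`C`-vector space `V` and `Q ≥ 2` an integer.  Grouping the eigenspaces `E_μ` of `S` according to
the algebraic degree `d μ` (`exists_degreeFun`) gives a finite grading `V = ⨁_{k < Nb} gr k` by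
sums of eigenspaces such that every endomorphism commuting with `S` preserves each `gr k`, every
`B` with `S B = Q • B S` raises the degree by one, and every `B` with `B S = Q • S B` lowers it by
one (killing `gr 0`).  (Port of the tree's `WeilDeligneRep.exists_eigenGrading`, which is the case
`C = ℂ`, `d μ = ⌊log_Q ‖μ‖⌋`.) -/
theorem exists_eigenGrading {C : Type*} [Field C] [CharZero C] [IsAlgClosed C] {V : Type*}
    [AddCommGroup V] [Module C V] [FiniteDimensional C V]
    (S : Module.End C V) (hS : S.IsSemisimple) (hSinj : Function.Injective S) {Q : ℕ} (hQ : 1 < Q) :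
    ∃ (gr : ℕ → Submodule C V) (Nb : ℕ),
      iSupIndep gr ∧ (⨆ k, gr k) = ⊤ ∧ (∀ k, Nb ≤ k → gr k = ⊥) ∧
      (∀ μ, ∃ k, S.eigenspace μ ≤ gr k) ∧
      (∀ A : V →ₗ[C] V, A ∘ₗ S = S ∘ₗ A → ∀ k, ∀ x ∈ gr k, A x ∈ gr k) ∧
      (∀ B : V →ₗ[C] V, S ∘ₗ B = (Q : C) • (B ∘ₗ S) → ∀ k, ∀ x ∈ gr k, B x ∈ gr (k + 1)) ∧
      (∀ B : V →ₗ[C] V, B ∘ₗ S = (Q : C) • (S ∘ₗ B) →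
        (∀ x ∈ gr 0, B x = 0) ∧ ∀ k, ∀ x ∈ gr (k + 1), B x ∈ gr k) := by
  classical
  set E : C → Submodule C V := fun μ => S.eigenspace μ with hE
  have hind0 : iSupIndep E := S.eigenspaces_iSupIndep
  have hsup0 : ⨆ μ, E μ = ⊤ := hS.iSup_eigenspace_eq_top
  have hQC : (Q : C) ≠ 0 := by exact_mod_cast (zero_lt_one.trans hQ).ne'
  have hmemE : ∀ (μ : C) (x : V), x ∈ E μ ↔ S x = μ • x := fun μ x =>
    Module.End.mem_eigenspace_iff
  -- the degree of an eigenvalue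
  obtain ⟨d, hd_mul⟩ := exists_degreeFun (C := C) hQ
  have hd_div : ∀ μ : C, μ ≠ 0 → d (μ / (Q : C)) = d μ - 1 := by
    intro μ hμ
    have := hd_mul (μ / (Q : C)) (div_ne_zero hμ hQC)
    rw [mul_div_cancel₀ _ hQC] at this
    omega
  -- eigenvalues are non-zero, finitely many
  have hE0 : ∀ μ : C, E μ ≠ ⊥ → μ ≠ 0 := by
    intro μ hμ h0
    apply hμ
    change S.eigenspace μ = ⊥
    rw [h0, Module.End.eigenspace_zero, LinearMap.ker_eq_bot]
    exact hSinj
  have hfin : Set.Finite {μ : C | E μ ≠ ⊥} := S.finite_hasEigenvalue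
  obtain ⟨d₀, hd₀⟩ := (hfin.image d).bddBelow
  obtain ⟨d₁, hd₁⟩ := (hfin.image d).bddAbove
  have hd₀' : ∀ μ, E μ ≠ ⊥ → d₀ ≤ d μ := fun μ hμ => hd₀ ⟨μ, hμ, rfl⟩
  have hd₁' : ∀ μ, E μ ≠ ⊥ → d μ ≤ d₁ := fun μ hμ => hd₁ ⟨μ, hμ, rfl⟩
  -- the grading
  let gr : ℕ → Submodule C V := fun k => ⨆ μ ∈ {μ : C | d μ = d₀ + k}, E μ
  have hgr_le : ∀ μ (k : ℕ), d μ = d₀ + k → E μ ≤ gr k := fun μ k h =>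
    le_iSup₂_of_le (f := fun μ (_ : μ ∈ {μ : C | d μ = d₀ + k}) => E μ) μ h le_rfl
  -- a degreewise statement is checked on eigenvectors
  have hgr_ind : ∀ (k : ℕ) (P : V → Prop), (∀ μ, d μ = d₀ + k → ∀ x ∈ E μ, P x) → P 0 →
      (∀ x y, P x → P y → P (x + y)) → ∀ x ∈ gr k, P x := by
    intro k P hP h0 hadd x hx
    refine Submodule.iSup_induction _ (motive := P) hx ?_ h0 hadd
    intro μ y hy
    by_cases hμ : d μ = d₀ + k
    · rw [iSup_pos (show μ ∈ {μ : C | d μ = d₀ + k} from hμ)] at hy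
      exact hP μ hμ y hy
    · rw [iSup_neg (show μ ∉ {μ : C | d μ = d₀ + k} from hμ), Submodule.mem_bot] at hy
      rw [hy]; exact h0
  -- vectors of the eigenspace `E 0 = ⊥` are zero
  have hx0 : ∀ x ∈ E 0, x = 0 := fun x hx => by
    by_contra hx0
    exact hE0 0 (fun h0 => hx0 (by rw [h0, Submodule.mem_bot] at hx; exact hx)) rfl
  refine ⟨gr, (d₁ - d₀ + 1).toNat, ?_, ?_, ?_, ?_, ?_, ?_, ?_⟩
  rotate_left 3
  · -- every eigenspace lies in some piece
    intro μ
    by_cases hμ : E μ = ⊥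
    · exact ⟨0, by change E μ ≤ gr 0; rw [hμ]; exact bot_le⟩
    · refine ⟨(d μ - d₀).toNat, hgr_le μ _ ?_⟩
      have := hd₀' μ hμ
      omega
  rotate_right 3
  · -- independence
    rw [iSupIndep_def]
    intro i
    have h1 : (⨆ (j) (_ : j ≠ i), gr j) ≤ ⨆ μ ∈ {μ : C | d μ ≠ d₀ + i}, E μ := by
      refine iSup₂_le fun j hj => iSup₂_le fun μ hμ => ?_
      refine le_iSup₂_of_le (f := fun μ (_ : μ ∈ {μ : C | d μ ≠ d₀ + i}) => E μ) μ ?_ le_rfl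
      change d μ = d₀ + j at hμ
      change d μ ≠ d₀ + i
      rw [hμ]; omega
    refine Disjoint.mono_right h1 ?_
    exact hind0.disjoint_biSup_biSup (Set.disjoint_left.mpr fun μ h1 h2 => h2 h1)
  · -- exhaustive
    rw [eq_top_iff, ← hsup0]
    refine iSup_le fun μ => ?_
    by_cases hμ : E μ = ⊥
    · rw [hμ]; exact bot_le
    · have h1 := hd₀' μ hμ
      refine le_iSup_of_le (d μ - d₀).toNat (hgr_le μ _ ?_)
      omega
  · -- bounded
    intro k hk
    rw [Submodule.eq_bot_iff]
    refine hgr_ind k (fun x => x = 0) (fun μ hμ x hx => ?_) rfl (fun x y hx hy => by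
      rw [hx, hy, add_zero])
    by_contra hx0
    have hne : E μ ≠ ⊥ := fun h => hx0 (by rw [h, Submodule.mem_bot] at hx; exact hx)
    have := hd₁' μ hne
    omega
  · -- commuting endomorphisms preserve the grading
    intro A hA k
    refine hgr_ind k (fun x => A x ∈ gr k) (fun μ hμ x hx => ?_) (by rw [map_zero]; exact zero_mem _)
      (fun x y hx hy => by rw [map_add]; exact add_mem hx hy)
    apply hgr_le μ k hμ
    rw [hmemE] at hx ⊢
    rw [← LinearMap.comp_apply, ← hA, LinearMap.comp_apply, hx, map_smul]
  · -- `S B = Q B S`: `B` raises the degree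
    intro B hB k
    refine hgr_ind k (fun x => B x ∈ gr (k + 1)) (fun μ hμ x hx => ?_)
      (by rw [map_zero]; exact zero_mem _) (fun x y hx hy => by rw [map_add]; exact add_mem hx hy)
    have hBx : B x ∈ E ((Q : C) * μ) := by
      rw [hmemE] at hx ⊢
      rw [← LinearMap.comp_apply, hB, LinearMap.smul_apply, LinearMap.comp_apply, hx, map_smul,
        smul_smul]
    by_cases hμ0 : μ = 0
    · rw [hμ0] at hx
      rw [hx0 x hx, map_zero]; exact zero_mem _
    · refine hgr_le _ (k + 1) ?_ hBx
      rw [hd_mul μ hμ0, hμ]; push_cast; ring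
  · -- `B S = Q S B`: `B` lowers the degree
    intro B hB
    have hBx : ∀ μ, ∀ x ∈ E μ, B x ∈ E (μ / (Q : C)) := by
      intro μ x hx
      rw [hmemE] at hx ⊢
      have h1 : B (S x) = (Q : C) • S (B x) := by
        rw [← LinearMap.comp_apply, hB]; rfl
      rw [hx, map_smul] at h1
      have h2 : S (B x) = (Q : C)⁻¹ • (μ • B x) := by
        rw [h1, smul_smul, inv_mul_cancel₀ hQC, one_smul]
      rw [h2, smul_smul, div_eq_inv_mul]
    have hzero : ∀ μ, d μ = d₀ → ∀ x ∈ E μ, B x = 0 := by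
      intro μ hμ x hx
      by_cases hμ0 : μ = 0
      · rw [hμ0] at hx
        rw [hx0 x hx, map_zero]
      · have h1 := hBx μ x hx
        by_contra hne
        have hne' : E (μ / (Q : C)) ≠ ⊥ := fun h => hne (by rw [h, Submodule.mem_bot] at h1; exact h1)
        have h2 := hd₀' _ hne'
        rw [hd_div μ hμ0] at h2
        omega
    refine ⟨?_, ?_⟩
    · refine hgr_ind 0 (fun x => B x = 0) (fun μ hμ x hx => hzero μ (by simpa using hμ) x hx)
        (map_zero B) (fun x y hx hy => by rw [map_add, hx, hy, add_zero])
    · intro k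
      refine hgr_ind (k + 1) (fun x => B x ∈ gr k) (fun μ hμ x hx => ?_)
        (by rw [map_zero]; exact zero_mem _) (fun x y hx hy => by rw [map_add]; exact add_mem hx hy)
      by_cases hμ0 : μ = 0
      · rw [hμ0] at hx
        rw [hx0 x hx, map_zero]; exact zero_mem _
      · refine hgr_le _ k ?_ (hBx μ x hx)
        rw [hd_div μ hμ0, hμ]; push_cast; ring

/-- **Maschke for finite image** over a field of characteristic `0`: a representation of a group
with finite image is semisimple (its invariant subspaces are those of the finite group `σ(G)`).
(Tree: `WeilDeligneRep.isSemisimpleRepresentation_of_finite_range`, the case `k = ℂ`.) -/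
theorem isSemisimpleRepresentation_of_finite_range {k : Type*} [Field k] [CharZero k]
    {G : Type*} [Group G] {E : Type*} [AddCommGroup E] [Module k E] (σ : Representation k G E)
    (hfin : (Set.range σ).Finite) : σ.IsSemisimpleRepresentation := by
  let H : Subgroup (E →ₗ[k] E)ˣ := σ.asGroupHom.range
  have hH : (Set.range σ.asGroupHom).Finite := by
    refine Set.Finite.of_finite_image (f := (Units.val : (E →ₗ[k] E)ˣ → E →ₗ[k] E)) ?_
      Units.val_injective.injOn
    refine hfin.subset ?_
    rintro _ ⟨_, ⟨g, rfl⟩, rfl⟩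
    exact ⟨g, (σ.asGroupHom_apply g).symm⟩
  haveI : Finite H := by
    have : (H : Set (E →ₗ[k] E)ˣ).Finite := by
      rw [MonoidHom.coe_range]; exact hH
    exact this.to_subtype
  haveI : NeZero (Nat.card H : k) := ⟨Nat.cast_ne_zero.mpr Nat.card_pos.ne'⟩
  let σH : Representation k H E := (Units.coeHom (E →ₗ[k] E)).comp H.subtype
  let e : Subrepresentation σ ≃o Subrepresentation σH :=
    { toFun := fun W ↦ ⟨W.toSubmodule, fun h v hv ↦ by
        obtain ⟨g, hg⟩ := h.2
        have : σH h = σ g := by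
          change ((h : (E →ₗ[k] E)ˣ) : E →ₗ[k] E) = σ g
          rw [← hg, Representation.asGroupHom_apply]
        rw [this]
        exact W.apply_mem_toSubmodule g hv⟩
      invFun := fun W ↦ ⟨W.toSubmodule, fun g v hv ↦ by
        have : σ g = σH ⟨σ.asGroupHom g, g, rfl⟩ := by
          change σ g = ((σ.asGroupHom g : (E →ₗ[k] E)ˣ) : E →ₗ[k] E)
          rw [Representation.asGroupHom_apply]
        rw [this]
        exact W.apply_mem_toSubmodule _ hv⟩
      left_inv := fun W ↦ by ext; rfl
      right_inv := fun W ↦ by ext; rfl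
      map_rel_iff' := Iff.rfl }
  exact e.complementedLattice_iff.mpr inferInstance

section FrobeniusScalar

variable {F : Type*} [Field F] [ValuativeRel F] [TopologicalSpace F] [IsNonarchimedeanLocalField F]
variable {C : Type*} [Field C] [CharZero C] [IsAlgClosed C]

/-- **Semisimplicity of a Weil-group representation on which a Frobenius power is scalar**, over an
algebraically closed field of characteristic `0`.  Let `τ` be a representation of `W_F` whose values
on inertia form a finite set, and `E` a subrepresentation on which `τ(Φᵐ)` (`deg Φ = 1`, `m ≥ 1`)
acts by a non-zero scalar `λ`.  Then `E` is semisimple: twisting by the unramified character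
`w ↦ ν^{-deg w}`, `νᵐ = λ`, gives a representation with finite image (`W_F = Φ^ℤ I_F`), semisimple
by Maschke, and twisting does not change the invariant subspaces.
(Tree: `WeilDeligneRep.isSemisimpleRepresentation_of_frobenius_scalar`, the case `C = ℂ`.) -/
theorem isSemisimpleRepresentation_of_frobenius_scalar {V : Type*} [AddCommGroup V] [Module C V]
    (τ : Representation C (WeilGroup F) V) {Φ : WeilGroup F} (hΦ : deg Φ = 1) {m : ℕ} (hm : 0 < m)
    (E : Subrepresentation τ) {lam : C} (hlam : lam ≠ 0)
    (hE : ∀ x ∈ E.toSubmodule, τ (Φ ^ m) x = lam • x)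
    (hfinI : ((fun w => τ w) '' (inertia F : Set (WeilGroup F))).Finite) :
    E.toRepresentation.IsSemisimpleRepresentation := by
  classical
  have hmul : IsFrobPow.mul (F := F) := IsFrobPow.mul_holds
  have huniq : IsFrobPow.unique (F := F) := IsFrobPow.unique_holds
  have hdegΦm : deg (Φ ^ m) = m := by rw [WeilDeligneRep.deg_pow, hΦ, mul_one]
  have hdecomp : ∀ w : WeilGroup F, w = Φ ^ (deg w) * (Φ ^ (-deg w) * w) := fun w => by
    rw [← mul_assoc, zpow_neg, mul_inv_cancel, one_mul]
  set σ := E.toRepresentation with hσ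
  have hσapp : ∀ w (x : E.toSubmodule), (σ w x : V) = τ w (x : V) := fun w x => rfl
  have hσΦm : ∀ x : E.toSubmodule, (σ (Φ ^ m) x : V) = lam • (x : V) := fun x => by
    rw [hσapp]; exact hE x x.2
  obtain ⟨ν, hν⟩ := IsAlgClosed.exists_pow_nat_eq lam hm
  have hν0 : ν ≠ 0 := by
    rintro rfl
    rw [zero_pow hm.ne'] at hν
    exact hlam hν.symm
  -- the unramified character `w ↦ ν⁻¹ ^ deg w`
  let χ : WeilGroup F →* Cˣ := (zpowersHom Cˣ (Units.mk0 ν hν0)⁻¹).comp (degHom F hmul huniq)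
  have hχval : ∀ w, ((χ w : Cˣ) : C) = ν⁻¹ ^ (deg w) := fun w => by
    change ((((zpowersHom Cˣ (Units.mk0 ν hν0)⁻¹) (degHom F hmul huniq w)) : Cˣ) : C) = _
    rw [degHom_apply, zpowersHom_apply, toAdd_ofAdd, Units.val_zpow_eq_zpow_val,
      Units.val_inv_eq_inv_val, Units.val_mk0]
  have hχI : ∀ i ∈ inertia F, ((χ i : Cˣ) : C) = 1 := fun i hi => by
    rw [hχval, WeilDeligneRep.deg_eq_zero_of_mem_inertia hi, zpow_zero]
  set σ' := Literature.RepresentationTheory.Semisimple.Representation.twist σ χ with hσ'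
  have hσ'app : ∀ w (x : E.toSubmodule), (σ' w x : V) = ((χ w : Cˣ) : C) • τ w (x : V) :=
    fun w x => rfl
  -- `σ'` on inertia only depends on `τ`
  have hkey : ∀ i ∈ inertia F, ∀ i' ∈ inertia F, τ i = τ i' →
      σ'.asGroupHom i = σ'.asGroupHom i' := by
    intro i hi i' hi' h
    apply Units.ext
    rw [Representation.asGroupHom_apply, Representation.asGroupHom_apply]
    apply LinearMap.ext
    intro x
    apply Subtype.ext
    rw [hσ'app, hσ'app, h, hχI i hi, hχI i' hi']
  -- `σ'` has finite image
  have hfinite : (Set.range σ').Finite := by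
    have hτ : (Set.range σ'.asGroupHom).Finite := by
      refine WeilDeligneRep.finite_range_of_frobenius_decomposition σ'.asGroupHom Φ hm ?_
        (inertia F : Set (WeilGroup F))
        (fun w => ⟨deg w, _, WeilDeligneRep.zpow_neg_deg_mul_mem_inertia hΦ w, hdecomp w⟩) ?_
      · -- `σ'(Φ)` has order dividing `m`
        apply Units.ext
        rw [← map_pow, Representation.asGroupHom_apply, Units.val_one]
        apply LinearMap.ext
        intro x
        apply Subtype.ext
        rw [hσ'app, ← hσapp, hσΦm x, smul_smul, hχval, hdegΦm]
        have : ν⁻¹ ^ (m : ℤ) * lam = 1 := by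
          rw [← hν, zpow_natCast, inv_pow, inv_mul_cancel₀ (pow_ne_zero m hν0)]
        rw [this, one_smul]
        rfl
      · -- finitely many values on inertia
        have hrep : ∀ A ∈ (fun w => τ w) '' (inertia F : Set (WeilGroup F)),
            ∃ i ∈ (inertia F : Set (WeilGroup F)), τ i = A := fun A hA => hA
        choose! rep hrep_mem hrep_eq using hrep
        refine ((hfinI.image rep).image σ'.asGroupHom).subset ?_
        rintro _ ⟨i, hi, rfl⟩
        refine ⟨rep (τ i), ⟨_, ⟨i, hi, rfl⟩, rfl⟩, ?_⟩
        exact hkey _ (hrep_mem _ ⟨i, hi, rfl⟩) i hi (hrep_eq _ ⟨i, hi, rfl⟩)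
    have hr : Set.range σ' = Units.val '' Set.range σ'.asGroupHom := by
      ext A
      constructor
      · rintro ⟨w, rfl⟩
        exact ⟨_, ⟨w, rfl⟩, σ'.asGroupHom_apply w⟩
      · rintro ⟨_, ⟨w, rfl⟩, rfl⟩
        exact ⟨w, (σ'.asGroupHom_apply w).symm⟩
    rw [hr]
    exact hτ.image _
  have h1 : σ'.IsSemisimpleRepresentation := isSemisimpleRepresentation_of_finite_range σ' hfinite
  exact (Literature.RepresentationTheory.Semisimple.Representation.isSemisimpleRepresentation_twist_iff
    σ χ).mp h1

end FrobeniusScalar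

end GenericWDU

end Summit.Langlands.Langlands.Theorems
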